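import Mathlib
import HarnessLib
import Summits.NavierStokesRegularity.NavierStokesRegularity.Theorems.PoloidalWindowDoorPoloidalWindowRigidityUntwistedDynamicsAnalytic
import Summits.NavierStokesRegularity.NavierStokesRegularity.Theorems.PoloidalWindowDoorPoloidalWindowRigidityUntwistedAssemblyCore

/-!
# Route `PoloidalWindowDoor`, crux `PoloidalWindowRigidity` (K2, stmt-NavierStokesRegularity-19708), skeleton `lrc-jet` v5 —
# STUB `stub_untwisted` PROVED: the untwisted non-degenerate stratum of the poloidal window is empty of singular profiles

Cell ns-regularity-ideate, K2 lead ns-poloidal-K2-p1 (gen 6; `--supports stmt-NavierStokesRegularity-19708`, the REGISTERED stub `stub_untwisted` of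
`Cruxes/PoloidalWindowRigidity/Lines/lrc_jet.lean` (skeleton sha16 c0fe89131f4fa547), signature verbatim).  UNTWISTED-NOTE §3 in the kernel:

  class + poloidal + open non-degenerate window `W` (curl v ≠ 0, ∇ₕv₂ ≠ 0, ∂₂vₕ ≠ 0) on which the twist bracket `{∂₂v₂, v₂}ₕ` vanishes
  ⇒ `v` is not backward-singular at the apex.

Proof = two tree theorems: the analytic NS₃ normal form of the untwisted stratum near a point of `W` (ns-poloidal-K2-p2 g5,
`…UntwistedDynamicsAnalytic.untwisted_normalForm_analytic`, p559247: structure functions `P, Λ, k, pₜ` analytic at the leaf points with `∂₂w = P(w,y₂)`,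
`(K1)`, `(V0)`, `(Sz)`, `Λ ∉ {0,1}`, `∇ₕw ≠ 0`) and the assembly core (K2 lead, `…UntwistedAssemblyCore.untwisted_regular_of_normalForm`, p558366: the
Wronskian dichotomy — leafwise isoparametric data ⇒ Segre ⇒ Killing germ of the vorticity ⇒ regular (bricks F1′, F3a/b, F5b/c; ns-poloidal-K2-p3's slice
Segre), or `D₁ ≡ D₃ ≡ 0` ⇒ the Stuart branch is empty (bricks F4 parts 1–4)).

WHAT THIS IS NOT: not the crux — the twisting stratum (`stub_twisting`, research residue; TWISTING-NOTE.md on the item) remains; not a claim about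
Navier–Stokes regularity (bears_on LADDER-NS N0 via crux K2 = stmt-19708).
-/

noncomputable section

-- the summit and its single sub-problem share the name (CONVENTIONS §1), as in every Theorems file
set_option linter.dupNamespace false

namespace Summit.NavierStokesRegularity.NavierStokesRegularity.Theorems.PoloidalWindowDoorPoloidalWindowRigidityStubUntwisted

open Set Function Filter Topology Metric
open scoped RealInnerProductSpace InnerProductSpace
open Literature.Analysis Literature.Analysis.FluidPDE
open Summit.NavierStokesRegularity.NavierStokesRegularity.Theorems.PoloidalWindowDoorPoloidalWindowRigidityUntwistedDynamicsAnalytic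
open Summit.NavierStokesRegularity.NavierStokesRegularity.Theorems.PoloidalWindowDoorPoloidalWindowRigidityUntwistedAssemblyCore

/-- **Stub `stub_untwisted` of skeleton lrc-jet v5 (crux K2 `PoloidalWindowRigidity`), VERBATIM signature:** a profile of the route's Type-I class,
poloidal along `e₃`, with an open non-empty non-degenerate window `W` of the backward slab on which the twist bracket vanishes, is not
backward-singular at the apex. -/
theorem stub_untwisted :
    ∀ (C : ℝ) (v : ℝ → EuclideanSpace ℝ (Fin 3) → EuclideanSpace ℝ (Fin 3)),
      Literature.Analysis.FluidPDE.HasTypeITimeDecay C v →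
      ContinuousOn (Function.uncurry v) (Set.Iio (0 : ℝ) ×ˢ Set.univ) →
      (∀ s t : ℝ, s < t → t < 0 → ∀ x, v t x =
        Literature.Analysis.UnboundedOperators.heatExtension (v s) (t - s) x -
          Literature.Analysis.FluidPDE.oseenDuhamel 1 s v v t x) →
      (∀ t < 0, Literature.Analysis.FluidPDE.VectorCalculus.IsDivFree (v t)) →
      (∀ s < 0, ∀ y, ⟪Literature.Analysis.FluidPDE.curl (v s) y, EuclideanSpace.single 2 1⟫_ℝ = 0) →
      ∀ W : Set (ℝ × EuclideanSpace ℝ (Fin 3)), IsOpen W → W.Nonempty → W ⊆ Set.Iio (0 : ℝ) ×ˢ Set.univ →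
        (∀ z ∈ W, Literature.Analysis.FluidPDE.curl (v z.1) z.2 ≠ 0 ∧
          (fderiv ℝ (v z.1) z.2 (EuclideanSpace.single 0 1) 2 ≠ 0 ∨ fderiv ℝ (v z.1) z.2 (EuclideanSpace.single 1 1) 2 ≠ 0) ∧
          (fderiv ℝ (v z.1) z.2 (EuclideanSpace.single 2 1) 0 ≠ 0 ∨ fderiv ℝ (v z.1) z.2 (EuclideanSpace.single 2 1) 1 ≠ 0)) →
        (∀ z ∈ W,
          fderiv ℝ (fun x => fderiv ℝ (v z.1) x (EuclideanSpace.single 2 1) 2) z.2 (EuclideanSpace.single 0 1) *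
              fderiv ℝ (v z.1) z.2 (EuclideanSpace.single 1 1) 2 -
            fderiv ℝ (fun x => fderiv ℝ (v z.1) x (EuclideanSpace.single 2 1) 2) z.2 (EuclideanSpace.single 1 1) *
              fderiv ℝ (v z.1) z.2 (EuclideanSpace.single 0 1) 2 = 0) →
        ¬ Literature.Analysis.FluidPDE.IsBackwardSingularPoint v 0 := by
  intro C v hrate hcont hmild hdiv hpol W hW hWne hWs hND htw
  obtain ⟨z₀, hz₀⟩ := hWne
  have hz₀' : (z₀.1, z₀.2) ∈ W := hz₀
  have hs : z₀.1 < 0 := (Set.mem_prod.mp (hWs hz₀)).1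
  obtain ⟨U, hUo, hy₀, -, P, Λ, k, pt, hPA, hΛA, hkA, hptA, hSd, hP, hnd, hL0, hL1, -, hK1, hV0, hSz⟩ :=
    untwisted_normalForm_analytic hrate hcont hmild hdiv hpol hW hWs hND htw hz₀'
  exact untwisted_regular_of_normalForm hrate hcont hmild hdiv hpol hs hUo hy₀ hPA hΛA hkA hptA hSd hP hnd hL0 hL1 hK1 hV0 hSz

end Summit.NavierStokesRegularity.NavierStokesRegularity.Theorems.PoloidalWindowDoorPoloidalWindowRigidityStubUntwisted

end
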